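import Summits.HodgeConjecture.CorCM.GaloisOddPrimeShapes
import Summits.HodgeConjecture.CorCM.GaloisMetacyclicTwoPowerAllTypes
import Mathlib.GroupTheory.SemidirectProduct
import HarnessLib

/-!
# SHAPE C(r) IS THE METACYCLIC MODEL `ℤ/p ⋊_r ℤ/2^{a+j+1}` OF GEN 27: GOOD for all abelian varieties when `r^{2^j} ≡ 1 (mod p)`,
# `1 ≤ j ≤ a + 1`, `2^{a+2} ∤ p − 1`, `2^{a+1} ∤ p + 1`

COR-CM (cell `pub-hodgecm2`), binder seat b04 (gen 38), count-neutral own lane «Galois-CM-type classification».  KERNEL ONLY: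
theorems; no definition, no named fact, no `sorry`.  `HC_CM` is neither used nor claimed.

Companion of `CorCM/GaloisOddPrimeShapeInversion` for a general exponent: in shape C(r) (`Gal(K/ℚ) = ⟨u⟩ ⋊ ⟨x⟩`, `u` of odd prime
order `p` generating a normal subgroup, `x` of order `2ⁿ`, `x u x⁻¹ = uʳ`) the group IS Mathlib's `Multiplicative (ZMod p) ⋊[φ]
Multiplicative (ZMod (2ⁿ))` for a `φ` with `φ(1) = (·)^{rᵏ}` for some `k` (`exists_mulEquiv_semidirect_of_conj_eq_pow`: complementary
cyclic subgroups, `SemidirectProduct.mulEquivSubgroup`, transport by `SemidirectProduct.congr'`; the generator of `ℤ/2ⁿ` pulls back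
to `xᵏ`, which acts by `u ↦ u^{rᵏ}`).  Since `(rᵏ)^{2^j} ≡ 1` as soon as `r^{2^j} ≡ 1`, gen 27's all-types theorem
(`GaloisMetacyclicTwoPower.hodgeConjectureFor_pow_of_not_dvd`) applies verbatim: **`[K:ℚ] = 2^{a+j+1}·p`, `r^{2^j} ≡ 1 (mod p)`,
`1 ≤ j ≤ a + 1`, `2^{a+2} ∤ p − 1`, `2^{a+1} ∤ p + 1` ⟹ the Hodge conjecture for every power of every abelian variety with CM by `K`**
(`hodgeConjectureFor_pow_of_shape_C`).  With `CorCM/GaloisLargeDegreeStructure` this settles shape C(r) of the five shapes outside the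
residue classes `p ≡ 1 (2^{a+2})`, `p ≡ −1 (2^{a+1})` and outside the actions of large `2`-power order (`j > a + 1`).

## References

* [Shimura1998] G. Shimura, *Abelian Varieties with Complex Multiplication and Modular Functions*, §5.1 Prop. 3, §6.2 Thm. 3, §8.2 Prop. 26.
* [Gordon1999HodgeAVSurvey] B. B. Gordon, *A survey of the Hodge conjecture for abelian varieties*, Thm. 6.4, §9.4.3.
* [Kubota1965] T. Kubota, *On the field extension by complex multiplication*, Trans. AMS 118 (1965), §4 Lemma 2.
* [Rotman1995] J. J. Rotman, *An Introduction to the Theory of Groups*, 4th ed., GTM 148, Thm. 7.20–7.23 (semidirect products).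
-/

noncomputable section

open CategoryTheory CategoryTheory.Limits NumberField
open scoped BigOperators

namespace Summit.HodgeConjecture.CorCM.GaloisModels

open Literature.NumberTheory.ComplexMultiplication Literature.AlgebraicGeometry.HodgeTheory
open Literature.AlgebraicGeometry.Motives (AbelianVariety CMType)
open Literature.AlgebraicGeometry.ComplexMultiplication (IsCMTypeRealisation)
open Literature.AlgebraicGeometry.Pohlmann1968 Summit.HodgeConjecture.CorCM.GaloisRank

/-! ## §1 The model isomorphism -/

section Group

variable {G : Type*} [Group G] [Finite G]

omit [Finite G] in
/-- `x u x⁻¹ = uʳ` ⟹ `xᵏ u x⁻ᵏ = u^{rᵏ}`. [folklore] -/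
theorem pow_conj_eq_pow_pow {u x : G} {r : ℕ} (hxu : x * u * x⁻¹ = u ^ r) (k : ℕ) : x ^ k * u * (x ^ k)⁻¹ = u ^ r ^ k := by
  induction k with
  | zero => simp
  | succ k ih =>
    calc x ^ (k + 1) * u * (x ^ (k + 1))⁻¹ = x * (x ^ k * u * (x ^ k)⁻¹) * x⁻¹ := by rw [pow_succ']; group
      _ = u ^ r ^ (k + 1) := by rw [ih, conj_pow_eq_pow_mul hxu, pow_succ, mul_comm]

/-- **Shape C(r) is a metacyclic model `ℤ/p ⋊ ℤ/2ⁿ`.**  `u` of prime order `p` generating a normal subgroup, `x` of order `2ⁿ`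
with `x u x⁻¹ = uʳ`, `|G| = 2ⁿ p` (`p` odd) ⟹ for some `k` and some `φ` with `φ(1) = (·)^{rᵏ}`:
`G ≃* Multiplicative (ZMod p) ⋊[φ] Multiplicative (ZMod (2ⁿ))`. [cite: Rotman1995, Thm. 7.20–7.23] -/
theorem exists_mulEquiv_semidirect_of_conj_eq_pow {u x : G} {p n r : ℕ} [hp : Fact p.Prime] (hp2 : p ≠ 2)
    (hou : orderOf u = p) [hP : (Subgroup.zpowers u).Normal] (hox : orderOf x = 2 ^ n) (hxu : x * u * x⁻¹ = u ^ r)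
    (hcard : Nat.card G = 2 ^ n * p) :
    ∃ (φ : Multiplicative (ZMod (2 ^ n)) →* MulAut (Multiplicative (ZMod p))) (k : ℕ),
      (∀ v : Multiplicative (ZMod p), φ (Multiplicative.ofAdd 1) v = v ^ r ^ k) ∧
        Nonempty (G ≃* Multiplicative (ZMod p) ⋊[φ] Multiplicative (ZMod (2 ^ n))) := by
  classical
  haveI : NeZero (2 ^ n) := ⟨by positivity⟩
  set P : Subgroup G := Subgroup.zpowers u with hPdef
  set S : Subgroup G := Subgroup.zpowers x with hSdef
  have hcardP : Nat.card P = p := by rw [hPdef, Nat.card_zpowers, hou]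
  have hcardS : Nat.card S = 2 ^ n := by rw [hSdef, Nat.card_zpowers, hox]
  -- `P` and `S` are complementary
  have hPS : P.IsComplement' S := by
    refine Subgroup.isComplement'_of_card_mul_and_disjoint ?_ (Subgroup.disjoint_of_coprime_natCard ?_)
    · rw [hcardP, hcardS, hcard, mul_comm]
    · rw [hcardP, hcardS]
      exact Nat.Coprime.pow_right _ (Nat.coprime_two_left.2 (hp.out.odd_of_ne_two hp2)).symm
  -- the cyclic models
  have hcardP' : Nat.card (Multiplicative (ZMod p)) = p := by simp
  have hcardS' : Nat.card S = Nat.card (Multiplicative (ZMod (2 ^ n))) := by simp [hcardS]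
  let fn : P ≃* Multiplicative (ZMod p) := mulEquivOfPrimeCardEq hcardP hcardP'
  haveI : IsCyclic S := by rw [hSdef]; infer_instance
  let fg : S ≃* Multiplicative (ZMod (2 ^ n)) := mulEquivOfCyclicCardEq hcardS'
  let e₀ := SemidirectProduct.mulEquivSubgroup hPS
  -- the generator `fg⁻¹(1)` is a power `xᵏ`, acting by `u ↦ u^{rᵏ}`
  set g : S := fg.symm (Multiplicative.ofAdd 1) with hg
  obtain ⟨k, hk⟩ := (Submonoid.mem_powers_iff _ _).1 (mem_powers_iff_mem_zpowers.2 (show (g : G) ∈ Subgroup.zpowers x from g.2))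
  refine ⟨_, k, ?_, ⟨e₀.symm.trans (SemidirectProduct.congr' fn fg)⟩⟩
  intro v
  have hgu : ∀ m : P, (g : G) * m * (g : G)⁻¹ = (m : G) ^ r ^ k := fun m => by
    obtain ⟨i, hi⟩ := (Submonoid.mem_powers_iff _ _).1 (mem_powers_iff_mem_zpowers.2 (show (m : G) ∈ Subgroup.zpowers u from m.2))
    rw [← hi, ← hk, conj_pow_eq_pow_mul (pow_conj_eq_pow_pow hxu k), pow_mul, ← pow_mul, ← pow_mul, mul_comm]
  have hψ : ∀ (hle : S ≤ Subgroup.normalizer (P : Set G)) (m : P),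
      (P.normalizerMonoidHom (Subgroup.inclusion hle g)) m = m ^ r ^ k := fun hle m => by
    apply Subtype.ext
    rw [Subgroup.normalizerMonoidHom_apply_apply_coe, Subgroup.coe_inclusion, Subgroup.coe_pow]
    exact hgu m
  simp only [MonoidHom.comp_apply, MonoidHom.coe_coe, MulAut.congr_apply, MulEquiv.trans_apply, ← hg]
  rw [hψ, map_pow, MulEquiv.apply_symm_apply]

end Group

/-! ## §2 Shape C(r) is GOOD for all abelian varieties under gen 27's conditions -/

variable {K : Type} [Field K] [NumberField K] [IsCMField K] [IsGalois ℚ K]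
variable {Φ : CMType K} {A : AbelianVariety ℂ} {ι : 𝓞 K →+* End A} {θ : K →+* Module.End ℂ (complexBetti A.X 1)}

omit [IsCMField K] [IsGalois ℚ K] in
/-- `rᵐ ≡ 1 (mod p)` passes to powers of `r`. [folklore] -/
theorem pow_pow_mod_eq_one {p r m k : ℕ} (hp : 1 < p) (hr : r ^ m % p = 1) : (r ^ k) ^ m % p = 1 := by
  rw [← pow_mul, mul_comm, pow_mul, Nat.pow_mod, hr, one_pow, Nat.mod_eq_of_lt hp]

/-- **SHAPE C(r): the Hodge conjecture for every power of every abelian variety with CM by `K`** when `[K:ℚ] = 2^{a+j+1}·p`,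
`Gal(K/ℚ) = ⟨u⟩ ⋊ ⟨x⟩` with `u` of odd prime order `p` (normal), `x` of order `2^{a+j+1}`, `x u x⁻¹ = uʳ` with `r^{2^j} ≡ 1 (mod p)`,
`1 ≤ j ≤ a + 1`, and `2^{a+2} ∤ p − 1`, `2^{a+1} ∤ p + 1` (gen 27). [cite: Shimura1998, §5.1 Prop. 3, §6.2 Thm. 3 and §8.2 Prop. 26]
[cite: Gordon1999HodgeAVSurvey, Thm. 6.4 and §9.4.3] [cite: Kubota1965, §4 Lemma 2] -/
theorem hodgeConjectureFor_pow_of_shape_C {p a j r : ℕ} [hp : Fact p.Prime] (hp2 : p ≠ 2) (hj1 : 1 ≤ j) (hja : j ≤ a + 1)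
    (hdeg : Module.finrank ℚ K = 2 ^ (a + j + 1) * p) {u x : K ≃ₐ[ℚ] K} (hou : orderOf u = p) [(Subgroup.zpowers u).Normal]
    (hox : orderOf x = 2 ^ (a + j + 1)) (hxu : x * u * x⁻¹ = u ^ r) (hr : r ^ 2 ^ j % p = 1)
    (h1 : ¬ 2 ^ (a + 2) ∣ p - 1) (h2 : ¬ 2 ^ (a + 1) ∣ p + 1) (hA : IsCMTypeRealisation Φ A ι θ) (N : ℕ) :
    HodgeConjectureFor (⨁ fun _ : Fin N => A).dim (⨁ fun _ : Fin N => A).X := by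
  obtain ⟨φ, k, hφ, ⟨e⟩⟩ := exists_mulEquiv_semidirect_of_conj_eq_pow hp2 hou hox hxu (by rw [IsGalois.card_aut_eq_finrank, hdeg])
  exact GaloisMetacyclicTwoPower.hodgeConjectureFor_pow_of_not_dvd hp2 hj1 hja h1 h2 φ (r ^ k) hφ
    (pow_pow_mod_eq_one hp.out.one_lt hr) e hA N

/-- … and stable nondegeneracy of every realisation. [cite: Gordon1999HodgeAVSurvey, Thm. 6.4] [cite: Kubota1965, §4 Lemma 2] -/
theorem isStablyNondegenerate_of_shape_C {p a j r : ℕ} [hp : Fact p.Prime] (hp2 : p ≠ 2) (hj1 : 1 ≤ j) (hja : j ≤ a + 1)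
    (hdeg : Module.finrank ℚ K = 2 ^ (a + j + 1) * p) {u x : K ≃ₐ[ℚ] K} (hou : orderOf u = p) [(Subgroup.zpowers u).Normal]
    (hox : orderOf x = 2 ^ (a + j + 1)) (hxu : x * u * x⁻¹ = u ^ r) (hr : r ^ 2 ^ j % p = 1)
    (h1 : ¬ 2 ^ (a + 2) ∣ p - 1) (h2 : ¬ 2 ^ (a + 1) ∣ p + 1) (hA : IsCMTypeRealisation Φ A ι θ) : IsStablyNondegenerate A := by
  obtain ⟨φ, k, hφ, ⟨e⟩⟩ := exists_mulEquiv_semidirect_of_conj_eq_pow hp2 hou hox hxu (by rw [IsGalois.card_aut_eq_finrank, hdeg])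
  exact GaloisMetacyclicTwoPower.isStablyNondegenerate_of_isCMTypeRealisation_of_not_dvd hp2 hj1 hja h1 h2 φ (r ^ k) hφ
    (pow_pow_mod_eq_one hp.out.one_lt hr) e hA

/-- **The `j = 1` case needs no hypothesis on `r`** (`r² ≡ 1` holds or not — we use `j` with `2^j = ` the exponent of `c`): in shape
C(r) with `[K:ℚ] = 2^{a+2}·p` and `x u x⁻¹ = uʳ` where `x²` centralises `u` (`r² ≡ 1 (mod p)`, i.e. `r ≡ ±1`), the Hodge conjecture
holds for all powers whenever `2^{a+2} ∤ p − 1`, `2^{a+1} ∤ p + 1`. [cite: Gordon1999HodgeAVSurvey, Thm. 6.4 and §9.4.3]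
[cite: Kubota1965, §4 Lemma 2] -/
theorem hodgeConjectureFor_pow_of_shape_C_sq {p a r : ℕ} [hp : Fact p.Prime] (hp2 : p ≠ 2)
    (hdeg : Module.finrank ℚ K = 2 ^ (a + 2) * p) {u x : K ≃ₐ[ℚ] K} (hou : orderOf u = p) [(Subgroup.zpowers u).Normal]
    (hox : orderOf x = 2 ^ (a + 2)) (hxu : x * u * x⁻¹ = u ^ r) (hr : r ^ 2 % p = 1)
    (h1 : ¬ 2 ^ (a + 2) ∣ p - 1) (h2 : ¬ 2 ^ (a + 1) ∣ p + 1) (hA : IsCMTypeRealisation Φ A ι θ) (N : ℕ) :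
    HodgeConjectureFor (⨁ fun _ : Fin N => A).dim (⨁ fun _ : Fin N => A).X :=
  hodgeConjectureFor_pow_of_shape_C (j := 1) hp2 le_rfl (by omega) hdeg hou hox hxu (by simpa using hr) h1 h2 hA N

end Summit.HodgeConjecture.CorCM.GaloisModels

end
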